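import Literature.MathematicalPhysics.QuantumFieldTheory.Balaban1983to89.B7SectCDGaugeAveragesRec
import Literature.MathematicalPhysics.QuantumFieldTheory.Balaban1983to89.B7Prop3FlatRecSide
import Literature.MathematicalPhysics.QuantumFieldTheory.Balaban1983to89.B7Prop9Flat

/-!
# `Balaban1983to89.B7Prop9FlatRec` — [Balaban1985Averaging] Proposition 9 (p. 49), (181)–(200), AT THE FLAT BACKGROUND, FOR THE RECORD's SITE AVERAGE (78) over CENTRED blocks
# ([Balaban1987RG1] (0.3)–(0.4)) — the record twin of the engine's `B7Prop9Flat` §3–§5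

statement-level skeleton of published theorems with citation tags; proofs where landed; nothing here is a claim about the Yang–Mills mass gap

CITATION HEADER (lean-in-tree rule).  Cell `pub-ymgap`, seat `pub-ymgap-dag-n05-e` g36 (N05-REC LEAD PEN); item R1 ([3] layer), Sect. G block (Props 8–10 for the record), file 1: the record twin of
`B7Prop9Flat` (lit-balaban p27).  `--kind proof --supports stmt-QuantumFields-20541` (K0⁷; count-neutral; no definition).  Sources READ: [3] = [Balaban1985Averaging] pp. 45–49 (176)–(200)
(`paper:balaban1985-cmp98-averaging`); [I] = [Balaban1987RG1] (0.3)–(0.4) pp. 252–253.  REUSED BY NAME (not restated): the engine's background-free layer `B7Prop9Flat.{SiteBd, BondBd, Vb, Ab,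
Vb_exp_data, walk_log, norm_asum_loop_le, asum_loop, eq182, cj_cj_inv, bmean_lin, length_seg_nat, setup, arith199, arith200, C4', C5', exp_add_eq_exp_mul_exp, exp_mul3_eq}`, `B7Eq170Flat.{bmean, cj, …}`,
the record's `B7SectCDGaugeAveragesRec.{SexpZ, savgZ}` (p690850), `BlockAveragingZd.offZ`, `B7Prop3FlatRecSide.l1_offZ_le_dL`.

WHAT IS PROVED (sorry-free).  The engine's §3–§5 with the block points `x = y + offZ L r` of the CENTRED block and the record's site average `savgZ`: `SexpZ_eq_bmean`, `SexpZ_mul` ((184) exponent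
identity), `norm_rem183Z_le` ((183): `‖σ(x)‖ ≤ 16pq`), ★`eq184Z` (`ṽ′(y) = v′(y)·exp[S_{v′}(y) + Φ]`, `‖Φ‖ ≤ 92pq`), `block_walkZ` ∕ `seg_walk` ∕ `loop_walkZ` ((182)∕(186)–(188)∕(193)–(195) on the
record's tree contours, `|Γ_{y,x}| ≤ dL`), ★`core200Z`, ★`core199Z`, ★★`prop9_flatZ` — PROPOSITION 9 AT `V₀ = 1` FOR THE RECORD: under (180a)–(180d) (the block condition on centred blocks) and
`50Lα′₃ ≤ 1`, `10³(d+1)Lα′₄ ≤ 1`: (199) `‖ṽ′(z)⁻¹ṽ′(z + e_μ) − 1‖ ≤ Lα′₄ + C′₄L²(α′₃α′₄ + α′₄²)` and (200) `‖ṽ′(z) − 1‖ ≤ α₄ + C′₅Lα′₄` for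
`ṽ′(z) = {v′v₁}_{B(Lz)}({v₁}_{B(Lz)})⁻¹` (`= vtilGZ L 1 v′ v₁ (Lz)`), same constants `C′₄ = 10⁴(d+1)²`, `C′₅ = 64(d+1)` as the engine.
HONEST SCOPE.  Port of the engine's flat Prop. 9 to the record's objects; the general-background Prop. 9∕10 for the record are the sequel; nothing of [3]∕[I] asserted beyond what is proved;
`HThm4Rec` UNDISCHARGED; N05 discharged of record untouched; N07 not claimable; counts unmoved (typed 28∕28 · discharged 8∕28); one finite 𝕋⁴ programme at fixed ε — nothing continuum ∕ ℝ⁴ ∕ OS ∕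
mass gap ∕ Clay.  No `def`, no `instance`, no `notation`, no `sorry`.
-/

set_option autoImplicit false

noncomputable section

open NormedSpace Finset Metric

namespace Literature.MathematicalPhysics.QuantumFieldTheory.Balaban1983to89.B7Prop9FlatRec

open B7Prop1Explicit hiding Site
open B7Prop1Explicit renaming Site → SiteZ
open MatrixLog B7Eq92Concrete B7Eq170Flat
open B7Eq167Flat (exp_sub_one_le_two_mul_of_le)
open B7Prop6Flat (norm_units_inv_sub_one_le)
open B7Prop9Flat (SiteBd BondBd Vb Ab Vb_exp_data walk_log norm_asum_loop_le asum_loop eq182 cj_cj_inv bmean_lin length_seg_nat setup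
  arith199 arith200 C4' C5' exp_add_eq_exp_mul_exp exp_mul3_eq)
open BlockAveragingZd (offZ)
open B7Prop3FlatRecSide (l1_offZ_le_dL)
open B7SectCDGaugeAveragesRec (SexpZ savgZ)

variable {d : ℕ}

/-! ## §3 (181)–(184): one averaging step of the product `v′v₁` over a block, with a BILINEAR remainder -/

section Repr

variable {𝔸 : Type*} [NormedRing 𝔸] [NormedAlgebra ℂ 𝔸] [CompleteSpace 𝔸]
variable (L : ℕ) (v' v₁ : SiteZ d → 𝔸ˣ) (y : SiteZ d)

/-- The record's site average (78) unfolded: `{g}_{B(y)} = g(y)·exp S_g(y)`. [cite: Balaban1985Averaging, (78) p.30; Balaban1987RG1, (0.3) p.252] -/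
theorem savgZ_apply (g : SiteZ d → 𝔸ˣ) : savgZ L g y = g y * expUnit (SexpZ L g y) := rfl

omit [CompleteSpace 𝔸] in
/-- The exponent (78) of the record's site average is a block mean over the CENTRED block (bis). [cite: Balaban1985Averaging, (78) p.30; Balaban1987RG1, (0.3) p.252] -/
theorem SexpZ_eq_bmean (g : SiteZ d → 𝔸ˣ) : SexpZ L g y = bmean L (fun r => mlog ((((g y)⁻¹ * g (y + offZ L r) : 𝔸ˣ)) : 𝔸)) := rfl

omit [CompleteSpace 𝔸] in
/-- **(184), the exponent** (summing (183) over the block): `S_{v′v₁}(y) = R(v₁⁻¹(y))S_{v′}(y) + S_{v₁}(y) + Σ_{x∈B(y)}L^{−d}σ(x)`,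
`S_g(y) = Σ_{x∈B(y)} L^{−d} log g(y)⁻¹g(x)` the exponent of (78) (`B7Eq99Concrete.Sexp`).  Print (184), first line:
"`ṽ′(y) = v′(y)v₁(y)exp[iΣ_{x∈B(y)}L^{−d}R(v₁⁻¹(y))(1/i) log v′⁻¹(y)(R_{0,y}v′)(x) + O(L²α′₃α′₄) + …]v₁⁻¹(y)`".
[cite: Balaban1985Averaging, (184) p.46, (78) p.30] -/
theorem SexpZ_mul :
    SexpZ L (v' * v₁) y = cj (v₁ y)⁻¹ (SexpZ L v' y) + SexpZ L v₁ y + bmean L (fun r : Fin d → Fin L => mlog (((((v' * v₁) y)⁻¹ * (v' * v₁) (y + offZ L r) : 𝔸ˣ)) : 𝔸) -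
    (cj (v₁ y)⁻¹ (mlog ((((v' y)⁻¹ * v' (y + offZ L r) : 𝔸ˣ)) : 𝔸)) + mlog ((((v₁ y)⁻¹ * v₁ (y + offZ L r) : 𝔸ˣ)) : 𝔸))) := by
  rw [SexpZ_eq_bmean, SexpZ_eq_bmean, SexpZ_eq_bmean, ← bmean_cj, ← bmean_add, ← bmean_add]
  congr 1
  funext r
  abel

variable {L v' v₁ y}
variable {p q : ℝ}
  (hp : ∀ r : Fin d → Fin L, ‖((((v' y)⁻¹ * v' (y + offZ L r) : 𝔸ˣ)) : 𝔸) - 1‖ ≤ p)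
  (hq : ∀ r : Fin d → Fin L, ‖((((v₁ y)⁻¹ * v₁ (y + offZ L r) : 𝔸ˣ)) : 𝔸) - 1‖ ≤ q)
  (hw : ‖((((v₁ y)⁻¹ : 𝔸ˣ)) : 𝔸) - 1‖ ≤ 2 / 5) (hw' : ‖((v₁ y : 𝔸ˣ) : 𝔸) - 1‖ ≤ 2 / 5)

include hp hq hw hw' in
/-- **(183), kernel form with an explicit constant**: under `‖v′⁻¹(y)v′(x) − 1‖ ≤ p`, `‖v₁⁻¹(y)v₁(x) − 1‖ ≤ q` on the block,
`p, q ≤ 1/50`, and the near-isometry hypotheses `‖v₁(y)^{∓1} − 1‖ ≤ 2/5` (print: `v₁` unitary, `R(v₁⁻¹(y))` an isometry):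
`‖σ(x)‖ ≤ 16pq` — BILINEAR ("`O(L²α′₃α′₄)`. A constant in the bound above is an absolute constant" — here `16`, with `p = O(Lα′₄)`,
`q = Lα′₃`).  Proof = print's: the two factors of (182) are `e^{R(v₁⁻¹(y)) log(…)}` and `e^{log(…)}` (norms `≤ 4p`, `2q`), merged by (31).
[cite: Balaban1985Averaging, (183) p.46, (31) p.22] -/
theorem norm_rem183Z_le (hp1 : p ≤ 1 / 50) (hq1 : q ≤ 1 / 50) (r : Fin d → Fin L) :
    ‖mlog (((((v' * v₁) y)⁻¹ * (v' * v₁) (y + offZ L r) : 𝔸ˣ)) : 𝔸) -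
      (cj (v₁ y)⁻¹ (mlog ((((v' y)⁻¹ * v' (y + offZ L r) : 𝔸ˣ)) : 𝔸)) + mlog ((((v₁ y)⁻¹ * v₁ (y + offZ L r) : 𝔸ˣ)) : 𝔸))‖
      ≤ 16 * p * q := by
  have hp0 : 0 ≤ p := (norm_nonneg _).trans (hp r)
  have hq0 : 0 ≤ q := (norm_nonneg _).trans (hq r)
  set x := y + offZ L r with hx
  set P : 𝔸 := cj (v₁ y)⁻¹ (mlog ((((v' y)⁻¹ * v' x : 𝔸ˣ)) : 𝔸)) with hPd
  set Q : 𝔸 := mlog ((((v₁ y)⁻¹ * v₁ x : 𝔸ˣ)) : 𝔸) with hQd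
  have hm' : ‖mlog ((((v' y)⁻¹ * v' x : 𝔸ˣ)) : 𝔸)‖ ≤ 2 * p :=
    (norm_mlog_le_two_mul ((hp r).trans (by linarith))).trans (by linarith [hp r])
  have hP : ‖P‖ ≤ 4 * p := (norm_cj_le_two_mul hw (by rw [inv_inv]; exact hw') _).trans (by linarith)
  have hQ : ‖Q‖ ≤ 2 * q := (norm_mlog_le_two_mul ((hq r).trans (by linarith))).trans (by linarith [hq r])
  have hPQ : ‖P‖ + ‖Q‖ ≤ 1 / 5 := by linarith
  have hlt' : ‖((((v' y)⁻¹ * v' x : 𝔸ˣ)) : 𝔸) - 1‖ < 1 := lt_of_le_of_lt (hp r) (by linarith)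
  have hlt₁ : ‖((((v₁ y)⁻¹ * v₁ x : 𝔸ˣ)) : 𝔸) - 1‖ < 1 := lt_of_le_of_lt (hq r) (by linarith)
  have hval : (((((v' * v₁) y)⁻¹ * (v' * v₁) x : 𝔸ˣ)) : 𝔸) = exp P * exp Q := by
    rw [eq182, Units.val_mul, val_Rc_eq_cj, hPd, hQd, exp_cj, exp_mlog hlt', exp_mlog hlt₁]
  have hσ : ‖bchRem P Q‖ ≤ 16 * p * q := by
    have h1 : ‖P‖ * ‖Q‖ ≤ 4 * p * ‖Q‖ := mul_le_mul_of_nonneg_right hP (norm_nonneg _)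
    have h2 : 4 * p * ‖Q‖ ≤ 4 * p * (2 * q) := mul_le_mul_of_nonneg_left hQ (by linarith)
    calc ‖bchRem P Q‖ ≤ 2 * ‖P‖ * ‖Q‖ := norm_bchRem_le hPQ
      _ ≤ 16 * p * q := by nlinarith
  have hZ : ‖P + Q + bchRem P Q‖ ≤ 1 / 5 := by
    have h16 : 16 * p * q ≤ 1 / 50 := by nlinarith
    calc ‖P + Q + bchRem P Q‖ ≤ ‖P‖ + ‖Q‖ + ‖bchRem P Q‖ := norm_add₃_le
      _ ≤ 1 / 5 := by linarith
  have hrem : mlog (((((v' * v₁) y)⁻¹ * (v' * v₁) x : 𝔸ˣ)) : 𝔸) - (P + Q) = bchRem P Q := by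
    rw [hval, exp_mul_exp_eq hPQ, mlog_exp_of_le hZ]
    abel
  rw [hrem]
  exact hσ

include hp hq hw hw' in
/-- **(181)–(184), kernel form at `V₀ = 1` with an explicit constant.**  The one-step average of the perturbation,
`ṽ′(y) := {v′v₁}_{B(y)}·({v₁}_{B(y)})⁻¹` ((178)/(179) at `V₀ = 1`, `{·}_{B(y)}` the site average (78) `B7Eq99Concrete.savg`),
satisfies `ṽ′(y) = v′(y)·exp[S_{v′}(y) + Φ]` with `‖Φ‖ ≤ 92pq` under the hypotheses of `norm_rem183_le` — print (184):
"`ṽ′(y) = … = v′(y)exp[iΣ_{x∈B(y)}L^{−d}(1/i) log v′⁻¹(y)(R_{0,y}v′)(x) + O(L²(α′₃ + α′₄)α′₄)]`".  Proof = print's ("Using (41) and (181),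
(183)"): `exp[R(v₁⁻¹(y))S′ + E + S₁] = exp[R(v₁⁻¹(y))S′ + E + Ψ]·exp[S₁]` by the bilinear (41) (`exp_add_eq_exp_mul_exp`,
`‖Ψ‖ ≤ 3·5p·2q`), the factor `exp[S₁]` cancels against `({v₁}_{B(y)})⁻¹ = exp[−S₁]v₁(y)⁻¹`, and `v₁(y)exp[R(v₁⁻¹(y))Z]v₁(y)⁻¹ = exp Z`
((57)); `Φ = R(v₁(y))(E + Ψ)`.  Every term of `Φ` carries a factor `p` (so `ṽ′ ≡ 1` when `v′ ≡ 1`): no `q²` term.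
[cite: Balaban1985Averaging, (181)–(184) p.46, (41) p.23, (57) p.27, (78) p.30] -/
theorem eq184Z (hL : 1 ≤ L) (hp1 : p ≤ 1 / 50) (hq1 : q ≤ 1 / 50) :
    ∃ Φ : 𝔸, savgZ L (v' * v₁) y * (savgZ L v₁ y)⁻¹ = v' y * expUnit (SexpZ L v' y + Φ) ∧ ‖Φ‖ ≤ 92 * p * q := by
  have hp0 : 0 ≤ p := (norm_nonneg _).trans (hp fun _ => ⟨0, hL⟩)
  have hq0 : 0 ≤ q := (norm_nonneg _).trans (hq fun _ => ⟨0, hL⟩)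
  have hS' : ‖SexpZ L v' y‖ ≤ 2 * p := by
    rw [SexpZ_eq_bmean]
    exact norm_bmean_le hL fun r => (norm_mlog_le_two_mul ((hp r).trans (by linarith))).trans (by linarith [hp r])
  have hS₁ : ‖SexpZ L v₁ y‖ ≤ 2 * q := by
    rw [SexpZ_eq_bmean]
    exact norm_bmean_le hL fun r => (norm_mlog_le_two_mul ((hq r).trans (by linarith))).trans (by linarith [hq r])
  have hE : ‖bmean L (fun r : Fin d → Fin L => mlog (((((v' * v₁) y)⁻¹ * (v' * v₁) (y + offZ L r) : 𝔸ˣ)) : 𝔸) -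
    (cj (v₁ y)⁻¹ (mlog ((((v' y)⁻¹ * v' (y + offZ L r) : 𝔸ˣ)) : 𝔸)) + mlog ((((v₁ y)⁻¹ * v₁ (y + offZ L r) : 𝔸ˣ)) : 𝔸)))‖ ≤ 16 * p * q := norm_bmean_le hL fun r => norm_rem183Z_le hp hq hw hw' hp1 hq1 r
  set S' := SexpZ L v' y with hS'd
  set S₁ := SexpZ L v₁ y with hS₁d
  set E := bmean L (fun r : Fin d → Fin L => mlog (((((v' * v₁) y)⁻¹ * (v' * v₁) (y + offZ L r) : 𝔸ˣ)) : 𝔸) -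
    (cj (v₁ y)⁻¹ (mlog ((((v' y)⁻¹ * v' (y + offZ L r) : 𝔸ˣ)) : 𝔸)) + mlog ((((v₁ y)⁻¹ * v₁ (y + offZ L r) : 𝔸ˣ)) : 𝔸))) with hEd
  set X := cj (v₁ y)⁻¹ S' + E with hXd
  have hcS' : ‖cj (v₁ y)⁻¹ S'‖ ≤ 4 * p := (norm_cj_le_two_mul hw (by rw [inv_inv]; exact hw') _).trans (by linarith)
  have hX : ‖X‖ ≤ 5 * p := by
    have h16 : 16 * p * q ≤ p := by nlinarith
    exact (norm_add_le _ _).trans (by linarith)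
  have hX' : ‖X‖ ≤ 1 / 10 := hX.trans (by linarith)
  have hS₁' : ‖S₁‖ ≤ 1 / 25 := hS₁.trans (by linarith)
  obtain ⟨Ψ, hΨ, hΨn⟩ := exp_add_eq_exp_mul_exp hX' hS₁'
  have hΨ' : ‖Ψ‖ ≤ 30 * p * q := by
    have h1 : ‖X‖ * ‖S₁‖ ≤ 5 * p * ‖S₁‖ := mul_le_mul_of_nonneg_right hX (norm_nonneg _)
    have h2 : 5 * p * ‖S₁‖ ≤ 5 * p * (2 * q) := mul_le_mul_of_nonneg_left hS₁ (by linarith)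
    nlinarith
  refine ⟨cj (v₁ y) (E + Ψ), ?_, ?_⟩
  · have hSx : SexpZ L (v' * v₁) y = X + S₁ := by
      rw [hXd, hS'd, hS₁d, hEd, SexpZ_mul]; abel
    have hu : expUnit (X + S₁) = expUnit (X + Ψ) * expUnit S₁ := by
      apply Units.ext
      simp only [Units.val_mul, val_expUnit]
      exact hΨ
    have hc : Rc (v₁ y) (expUnit (X + Ψ)) = expUnit (S' + cj (v₁ y) (E + Ψ)) := by
      rw [← expUnit_conj, ← cj_apply, hXd, add_assoc, cj_add, cj_cj_inv]
    rw [savgZ_apply, savgZ_apply, Pi.mul_apply, hSx, ← hS₁d, hu, ← hc, Rc_apply]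
    group
  · calc ‖cj (v₁ y) (E + Ψ)‖ ≤ 2 * ‖E + Ψ‖ := norm_cj_le_two_mul hw' hw _
      _ ≤ 2 * (‖E‖ + ‖Ψ‖) := by gcongr; exact norm_add_le _ _
      _ ≤ 92 * p * q := by linarith

end Repr

/-! ## §4 The averaged perturbation (178)–(179) and Proposition 9, (199)–(200), at the flat background -/

section Prop9

variable {𝔸 : Type*} [NormedRing 𝔸] [NormedAlgebra ℂ 𝔸] [CompleteSpace 𝔸]

/-- **(182)/(187) on a block**: under `V′_b = e^{A_b}`, `‖A_b‖ ≤ a`, `(d+1)La ≤ θ ≤ 1/64`, for the tree contour `Γ_{y,x}`,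
`x = y + r ∈ B(y)` (`|Γ_{y,x}| ≤ dL`): `‖v′(y)⁻¹v′(x) − 1‖ ≤ 2θ` (print (182): "`< |Γ_{y,x}|α′₄e^{|Γ_{y,x}|α′₄} = O(Lα′₄)`"),
`‖log v′(y)⁻¹v′(x)‖ ≤ 4θ`, `‖log v′(y)⁻¹v′(x) − A(Γ_{y,x})‖ ≤ 17θ²` (print (187)), `‖A(Γ_{y,x})‖ ≤ θ`.
[cite: Balaban1985Averaging, (182) p.46, (187) p.47] -/
theorem block_walkZ {v : SiteZ d → 𝔸ˣ} {a θ : ℝ} {L : ℕ} (ha0 : 0 ≤ a)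
    (hVA : ∀ (x : SiteZ d) (κ : Fin d), ((Vb v x κ : 𝔸ˣ) : 𝔸) = exp (Ab v x κ) ∧ ‖Ab v x κ‖ ≤ a)
    (hθ0 : 0 ≤ θ) (hθ1 : θ ≤ 1 / 64) (hLa : ((d : ℝ) + 1) * L * a ≤ θ) (y : SiteZ d) (r : Fin d → Fin L) :
    ‖((((v y)⁻¹ * v (y + offZ L r) : 𝔸ˣ)) : 𝔸) - 1‖ ≤ 2 * θ ∧
      ‖mlog ((((v y)⁻¹ * v (y + offZ L r) : 𝔸ˣ)) : 𝔸)‖ ≤ 4 * θ ∧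
      ‖mlog ((((v y)⁻¹ * v (y + offZ L r) : 𝔸ˣ)) : 𝔸) - asum (Ab v) y (treeWord (offZ L r))‖ ≤ 17 * θ ^ 2 ∧
      ‖asum (Ab v) y (treeWord (offZ L r))‖ ≤ θ := by
  have hlen : ((treeWord (offZ L r)).length : ℝ) * a ≤ θ := by
    rw [length_treeWord]
    have h1 : (l1 (offZ L r) : ℝ) ≤ d * L := by exact_mod_cast l1_offZ_le_dL L r
    have h2 : (0 : ℝ) ≤ L * a := by positivity
    calc (l1 (offZ L r) : ℝ) * a ≤ (d * L : ℝ) * a := mul_le_mul_of_nonneg_right h1 ha0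
      _ ≤ θ := by nlinarith
  have h := walk_log ha0 hVA hθ0 hθ1 y (treeWord (offZ L r)) hlen
  rwa [disp_treeWord] at h

/-- **(186)–(188) on a coarse bond**: for the straight word `c` of `L` bonds from `y` in direction `μ` (print: the bond
`c = ⟨y, y′⟩ ∈ T_{L^{-1}}`, `y′ = y + Le_μ`): `‖v′(y)⁻¹v′(y′) − 1‖ ≤ 2θ`, `‖log v′(y)⁻¹v′(y′)‖ ≤ 4θ`,
`‖log v′(y)⁻¹v′(y′) − A(c)‖ ≤ 17θ²` (print, p. 47 between (188) and (189): "Further we can write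
`v′⁻¹(c₋)R(V₀(c))v′(c₊) = (R_{0,c₋}V′)(c) = 1 + i(R_{0,c₋}A)(c) + O((Lα′₄)²)`" — at `V₀ = 1`, `R(V₀(c)) = id`), `‖A(c)‖ ≤ θ`.
[cite: Balaban1985Averaging, (186) p.46, (187)–(189) p.47] -/
theorem seg_walk {v : SiteZ d → 𝔸ˣ} {a θ : ℝ} {L : ℕ} (ha0 : 0 ≤ a)
    (hVA : ∀ (x : SiteZ d) (κ : Fin d), ((Vb v x κ : 𝔸ˣ) : 𝔸) = exp (Ab v x κ) ∧ ‖Ab v x κ‖ ≤ a)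
    (hθ0 : 0 ≤ θ) (hθ1 : θ ≤ 1 / 64) (hLa : ((d : ℝ) + 1) * L * a ≤ θ) (y : SiteZ d) (μ : Fin d) :
    ‖((((v y)⁻¹ * v (y + (L : ℤ) • e μ) : 𝔸ˣ)) : 𝔸) - 1‖ ≤ 2 * θ ∧
      ‖mlog ((((v y)⁻¹ * v (y + (L : ℤ) • e μ) : 𝔸ˣ)) : 𝔸)‖ ≤ 4 * θ ∧
      ‖mlog ((((v y)⁻¹ * v (y + (L : ℤ) • e μ) : 𝔸ˣ)) : 𝔸) - asum (Ab v) y (seg μ (L : ℤ))‖ ≤ 17 * θ ^ 2 ∧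
      ‖asum (Ab v) y (seg μ (L : ℤ))‖ ≤ θ := by
  have hlen : ((seg μ (L : ℤ)).length : ℝ) * a ≤ θ := by
    rw [length_seg_nat]
    have h2 : (0 : ℝ) ≤ d * (L * a) := by positivity
    nlinarith
  have h := walk_log ha0 hVA hθ0 hθ1 y (seg μ (L : ℤ)) hlen
  rwa [disp_seg] at h

/-- **(193)–(195) on a block**: the closed contour `Γ_{y,x} ∪ [x,x′] ∪ (−Γ_{y′,x′}) ∪ (−c)` of (191)–(192) (length
`≤ 2(d+1)L`) has `‖A(loop)‖ ≤ 4θ²` under `(d+1)La ≤ θ ≤ 1/128` (print (193)–(195): "`(R_{0,c₋}A)(Γ_{c,x} ∪ (−c)) =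
(1/i) log(R_{0,c₋}V′)(Γ_{c,x} ∪ (−c)) + O((Lα′₄)²)`, (193) … `= 1 + O(L²α₀α₄)`, (194) hence `(R_{0,c₋}A)(Γ_{c,x} ∪ (−c)) =
O(L²(α₀α₄ + α′₄²))`. (195)"; at `V₀ = 1` only the `α′₄²`-term). [cite: Balaban1985Averaging, (193)–(195) p.48] -/
theorem loop_walkZ {v : SiteZ d → 𝔸ˣ} {a θ : ℝ} {L : ℕ} (ha0 : 0 ≤ a)
    (hVA : ∀ (x : SiteZ d) (κ : Fin d), ((Vb v x κ : 𝔸ˣ) : 𝔸) = exp (Ab v x κ) ∧ ‖Ab v x κ‖ ≤ a)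
    (hθ0 : 0 ≤ θ) (hθ1 : θ ≤ 1 / 128) (hLa : ((d : ℝ) + 1) * L * a ≤ θ) (y : SiteZ d) (r : Fin d → Fin L) (μ : Fin d) :
    ‖asum (Ab v) y (treeWord (offZ L r) ++ seg μ (L : ℤ) ++ revWord (treeWord (offZ L r)) ++ revWord (seg μ (L : ℤ)))‖
      ≤ 4 * θ ^ 2 := by
  have hlen : ((treeWord (offZ L r) ++ seg μ (L : ℤ) ++ revWord (treeWord (offZ L r)) ++
      revWord (seg μ (L : ℤ))).length : ℝ) * a ≤ 2 * θ := by
    simp only [List.length_append, length_revWord, length_treeWord, length_seg_nat, Nat.cast_add]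
    have h1 : (l1 (offZ L r) : ℝ) ≤ d * L := by exact_mod_cast l1_offZ_le_dL L r
    have h2 : (0 : ℝ) ≤ L * a := by positivity
    have h3 : (l1 (offZ L r) : ℝ) * a ≤ (d * L : ℝ) * a := mul_le_mul_of_nonneg_right h1 ha0
    nlinarith
  have hdisp : disp (treeWord (offZ L r) ++ seg μ (L : ℤ) ++ revWord (treeWord (offZ L r)) ++
      revWord (seg μ (L : ℤ))) = 0 := by
    simp only [disp_append, disp_revWord, disp_treeWord, disp_seg]
    abel
  have h := norm_asum_loop_le ha0 hVA (θ := 2 * θ) (by positivity) (by linarith) y _ hlen hdisp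
  calc _ ≤ (2 * θ) ^ 2 := h
    _ = 4 * θ ^ 2 := by ring

/-- **(200), the core estimate at one block** (print: "`|ṽ′(y) − 1| < α₄ + C′₅Lα′₄`"): with `θ ≥ (d+1)La` as in `block_walk`
(`θ ≤ 1/500`), `‖v₁(y)⁻¹v₁(x) − 1‖ ≤ q ≤ 1/50` on the block and `‖v′(y) − 1‖ ≤ α₄ ≤ 1`:
`‖ṽ′ − 1‖ ≤ α₄ + 16θ + 736θq` (from (184): `ṽ′ = v′(y)e^{S′+Φ}`, `‖S′‖ ≤ 4θ`, `‖Φ‖ ≤ 184θq`).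
[cite: Balaban1985Averaging, (200) p.49, (184) p.46] -/
theorem core200Z {L : ℕ} (hL : 1 ≤ L) {v' v₁ : SiteZ d → 𝔸ˣ} {a θ q α₄ : ℝ} (ha0 : 0 ≤ a)
    (hVA : ∀ (x : SiteZ d) (κ : Fin d), ((Vb v' x κ : 𝔸ˣ) : 𝔸) = exp (Ab v' x κ) ∧ ‖Ab v' x κ‖ ≤ a)
    (hθ0 : 0 ≤ θ) (hθ1 : θ ≤ 1 / 500) (hLa : ((d : ℝ) + 1) * L * a ≤ θ)
    (hw : ∀ x, ‖((((v₁ x)⁻¹ : 𝔸ˣ)) : 𝔸) - 1‖ ≤ 2 / 5) (hw' : ∀ x, ‖((v₁ x : 𝔸ˣ) : 𝔸) - 1‖ ≤ 2 / 5)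
    (hq1 : q ≤ 1 / 50) (hα₄ : α₄ ≤ 1) (y : SiteZ d)
    (hq : ∀ r : Fin d → Fin L, ‖((((v₁ y)⁻¹ * v₁ (y + offZ L r) : 𝔸ˣ)) : 𝔸) - 1‖ ≤ q)
    (h4a : ‖((v' y : 𝔸ˣ) : 𝔸) - 1‖ ≤ α₄) :
    ‖(((savgZ L (v' * v₁) y * (savgZ L v₁ y)⁻¹ : 𝔸ˣ)) : 𝔸) - 1‖ ≤ α₄ + 16 * θ + 736 * θ * q := by
  have hq0 : 0 ≤ q := (norm_nonneg _).trans (hq fun _ => ⟨0, hL⟩)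
  have hθ64 : θ ≤ 1 / 64 := hθ1.trans (by norm_num)
  have hb := block_walkZ ha0 hVA hθ0 hθ64 hLa
  obtain ⟨Φ, hΦ, hΦn⟩ := eq184Z (fun r => (hb y r).1) hq (hw y) (hw' y) hL (by linarith) hq1
  have hS : ‖SexpZ L v' y‖ ≤ 4 * θ := by
    rw [SexpZ_eq_bmean]; exact norm_bmean_le hL fun r => (hb y r).2.1
  have hΦ1 : ‖Φ‖ ≤ 184 * θ * q := hΦn.trans (by linarith)
  have hqθ : 184 * θ * q ≤ 4 * θ := by nlinarith
  have hM : ‖SexpZ L v' y + Φ‖ ≤ 4 * θ + 184 * θ * q := (norm_add_le _ _).trans (add_le_add hS hΦ1)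
  have hm : ‖exp (SexpZ L v' y + Φ) - 1‖ ≤ 2 * (4 * θ + 184 * θ * q) :=
    (B7Transfer.norm_exp_sub_one_le_of_le _ hM).trans
      (exp_sub_one_le_two_mul_of_le (by positivity) le_rfl (by linarith))
  rw [hΦ, Units.val_mul, val_expUnit]
  have h1 := B7Prop6Bound.mul_sub_one_norm_le ((v' y : 𝔸ˣ) : 𝔸) (exp (SexpZ L v' y + Φ))
  have hA0 := norm_nonneg (((v' y : 𝔸ˣ) : 𝔸) - 1)
  have hB0 := norm_nonneg (exp (SexpZ L v' y + Φ) - 1)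
  have hAB : ‖((v' y : 𝔸ˣ) : 𝔸) - 1‖ * ‖exp (SexpZ L v' y + Φ) - 1‖ ≤ 1 * ‖exp (SexpZ L v' y + Φ) - 1‖ :=
    mul_le_mul_of_nonneg_right (h4a.trans hα₄) hB0
  have hid : (1 + ‖((v' y : 𝔸ˣ) : 𝔸) - 1‖) * (1 + ‖exp (SexpZ L v' y + Φ) - 1‖) - 1 =
      ‖((v' y : 𝔸ˣ) : 𝔸) - 1‖ + ‖exp (SexpZ L v' y + Φ) - 1‖ +
        ‖((v' y : 𝔸ˣ) : 𝔸) - 1‖ * ‖exp (SexpZ L v' y + Φ) - 1‖ := by ring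
  linarith

/-- **(199), the core estimate at one coarse bond** (print: "`|ṽ′⁻¹(c₋)R̄_{0,c}ṽ′(c₊) − 1| < Lα′₄ + C′₄L²(α₀α₄ + α′₃α′₄ + α′₄²)`",
`c = ⟨y, y′⟩`, `y′ = y + Le_μ`; at `V₀ = 1`, `R̄_{0,c} = id` and `α₀ = 0`): with `θ ≥ (d+1)La`, `θ ≤ 1/500`, the block
hypothesis `‖v₁(·)⁻¹v₁(x) − 1‖ ≤ q ≤ 1/50` at both corners: `‖ṽ′(y)⁻¹ṽ′(y′) − 1‖ ≤ La + 2300θ² + 368θq` — the LEADING TERM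
`La` (`≤ Lα′₄(1 + 4α′₄)`) is print's `Lα′₄` with coefficient exactly one (it is `|Σ_{x∈B(y)}L^{−d}A([x,x′])| ≤ L·sup|A_b|`, the
main term of (192)/(196)); the error is second order and carries no `q²`.  Proof = print's pp. 47–49 at `V₀ = 1`: (184) at `y`
and `y′`, (186)–(188) for `v′(y)⁻¹v′(y′) = e^{A(c) + O(θ²)}`, the three exponentials merged by (31) (`exp_mul3_eq`), the linear
terms `−S′(y) + A(c) + S′(y′)` rearranged by (189)–(192) into `Σ L^{−d}[A([x,x′]) − A(loop_x)]` (`asum_loop`, `bmean_lin`), the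
loops bounded by (193)–(195) (`loop_walk`), and `|e^M − 1| ≤ |M| + |M|²`. [cite: Balaban1985Averaging, (199) p.49, (185)–(198) pp.46–49] -/
theorem core199Z {L : ℕ} (hL : 1 ≤ L) {v' v₁ : SiteZ d → 𝔸ˣ} {a θ q : ℝ} (ha0 : 0 ≤ a)
    (hVA : ∀ (x : SiteZ d) (κ : Fin d), ((Vb v' x κ : 𝔸ˣ) : 𝔸) = exp (Ab v' x κ) ∧ ‖Ab v' x κ‖ ≤ a)
    (hθ0 : 0 ≤ θ) (hθ1 : θ ≤ 1 / 500) (hLa : ((d : ℝ) + 1) * L * a ≤ θ)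
    (hw : ∀ x, ‖((((v₁ x)⁻¹ : 𝔸ˣ)) : 𝔸) - 1‖ ≤ 2 / 5) (hw' : ∀ x, ‖((v₁ x : 𝔸ˣ) : 𝔸) - 1‖ ≤ 2 / 5)
    (hq1 : q ≤ 1 / 50) (y : SiteZ d) (μ : Fin d)
    (hq : ∀ r : Fin d → Fin L, ‖((((v₁ y)⁻¹ * v₁ (y + offZ L r) : 𝔸ˣ)) : 𝔸) - 1‖ ≤ q)
    (hq' : ∀ r : Fin d → Fin L,
      ‖((((v₁ (y + (L : ℤ) • e μ))⁻¹ * v₁ (y + (L : ℤ) • e μ + offZ L r) : 𝔸ˣ)) : 𝔸) - 1‖ ≤ q) :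
    ‖((((savgZ L (v' * v₁) y * (savgZ L v₁ y)⁻¹)⁻¹ *
        (savgZ L (v' * v₁) (y + (L : ℤ) • e μ) * (savgZ L v₁ (y + (L : ℤ) • e μ))⁻¹) : 𝔸ˣ)) : 𝔸) - 1‖
      ≤ L * a + 2300 * θ ^ 2 + 368 * θ * q := by
  have hq0 : 0 ≤ q := (norm_nonneg _).trans (hq fun _ => ⟨0, hL⟩)
  have hθ64 : θ ≤ 1 / 64 := hθ1.trans (by norm_num)
  have hLa' : (L : ℝ) * a ≤ θ := by
    have : (0 : ℝ) ≤ d * (L * a) := by positivity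
    nlinarith
  set y' := y + (L : ℤ) • e μ with hy'
  have hb := block_walkZ ha0 hVA hθ0 hθ64 hLa
  obtain ⟨hc1, hc2, hc3, -⟩ := seg_walk ha0 hVA hθ0 hθ64 hLa y μ
  rw [← hy'] at hc1 hc2 hc3
  -- (184) at the two corners
  obtain ⟨Φ, hΦ, hΦn⟩ := eq184Z (fun r => (hb y r).1) hq (hw y) (hw' y) hL (by linarith) hq1
  obtain ⟨Φ', hΦ', hΦ'n⟩ := eq184Z (fun r => (hb y' r).1) hq' (hw y') (hw' y') hL (by linarith) hq1
  have hS : ‖SexpZ L v' y‖ ≤ 4 * θ := by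
    rw [SexpZ_eq_bmean]; exact norm_bmean_le hL fun r => (hb y r).2.1
  have hS' : ‖SexpZ L v' y'‖ ≤ 4 * θ := by
    rw [SexpZ_eq_bmean]; exact norm_bmean_le hL fun r => (hb y' r).2.1
  set φ := 184 * θ * q with hφd
  have hΦ1 : ‖Φ‖ ≤ φ := hΦn.trans (by rw [hφd]; linarith)
  have hΦ'1 : ‖Φ'‖ ≤ φ := hΦ'n.trans (by rw [hφd]; linarith)
  have hφ0 : 0 ≤ φ := by rw [hφd]; positivity
  have hφθ : φ ≤ 4 * θ := by rw [hφd]; nlinarith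
  -- the three exponents
  have hB₁ : ‖-(SexpZ L v' y + Φ)‖ ≤ 4 * θ + φ := by
    rw [norm_neg]; exact (norm_add_le _ _).trans (add_le_add hS hΦ1)
  have hB₃ : ‖SexpZ L v' y' + Φ'‖ ≤ 4 * θ + φ := (norm_add_le _ _).trans (add_le_add hS' hΦ'1)
  have hsum : ‖-(SexpZ L v' y + Φ)‖ + ‖mlog ((((v' y)⁻¹ * v' y' : 𝔸ˣ)) : 𝔸)‖ + ‖SexpZ L v' y' + Φ'‖ ≤ 12 * θ + 2 * φ := by
    linarith
  have hs20 : 12 * θ + 2 * φ ≤ 1 / 20 := by linarith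
  obtain ⟨ρ, hρ, hρn⟩ := exp_mul3_eq hsum hs20
  have hρ' : ‖ρ‖ ≤ 2000 * θ ^ 2 := by
    have h0 : 0 ≤ 12 * θ + 2 * φ := by positivity
    have h1 : (12 * θ + 2 * φ) ^ 2 ≤ (20 * θ) ^ 2 := pow_le_pow_left₀ h0 (by linarith) 2
    nlinarith
  -- the value of the quotient
  have hWlt : ‖((((v' y)⁻¹ * v' y' : 𝔸ˣ)) : 𝔸) - 1‖ < 1 := lt_of_le_of_lt hc1 (by linarith)
  have hWexp : ((((v' y)⁻¹ * v' y' : 𝔸ˣ)) : 𝔸) = exp (mlog ((((v' y)⁻¹ * v' y' : 𝔸ˣ)) : 𝔸)) := (exp_mlog hWlt).symm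
  have hquot : (savgZ L (v' * v₁) y * (savgZ L v₁ y)⁻¹)⁻¹ * (savgZ L (v' * v₁) y' * (savgZ L v₁ y')⁻¹) =
      (expUnit (SexpZ L v' y + Φ))⁻¹ * ((v' y)⁻¹ * v' y') * expUnit (SexpZ L v' y' + Φ') := by
    rw [hΦ, hΦ']; group
  rw [hquot, val_inv_expUnit, Units.val_mul, Units.val_mul, val_expUnit, val_expUnit, hWexp, hρ]
  -- the exponent, rearranged by (189)–(192)
  set M := -(SexpZ L v' y + Φ) + mlog ((((v' y)⁻¹ * v' y' : 𝔸ˣ)) : 𝔸) + (SexpZ L v' y' + Φ') + ρ with hMd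
  have hMid : M = bmean L (fun r => asum (Ab v') (y + offZ L r) (seg μ (L : ℤ)) -
        asum (Ab v') y (treeWord (offZ L r) ++ seg μ (L : ℤ) ++ revWord (treeWord (offZ L r)) ++
          revWord (seg μ (L : ℤ))) +
        ((mlog ((((v' y')⁻¹ * v' (y' + offZ L r) : 𝔸ˣ)) : 𝔸) - asum (Ab v') y' (treeWord (offZ L r))) -
         (mlog ((((v' y)⁻¹ * v' (y + offZ L r) : 𝔸ˣ)) : 𝔸) - asum (Ab v') y (treeWord (offZ L r))))) +
      (mlog ((((v' y)⁻¹ * v' y' : 𝔸ˣ)) : 𝔸) - asum (Ab v') y (seg μ (L : ℤ))) + (Φ' - Φ) + ρ := by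
    have hpt : (fun r => asum (Ab v') (y + offZ L r) (seg μ (L : ℤ)) -
        asum (Ab v') y (treeWord (offZ L r) ++ seg μ (L : ℤ) ++ revWord (treeWord (offZ L r)) ++
          revWord (seg μ (L : ℤ))) +
        ((mlog ((((v' y')⁻¹ * v' (y' + offZ L r) : 𝔸ˣ)) : 𝔸) - asum (Ab v') y' (treeWord (offZ L r))) -
         (mlog ((((v' y)⁻¹ * v' (y + offZ L r) : 𝔸ˣ)) : 𝔸) - asum (Ab v') y (treeWord (offZ L r))))) =
        (fun r => mlog ((((v' y')⁻¹ * v' (y' + offZ L r) : 𝔸ˣ)) : 𝔸) -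
          mlog ((((v' y)⁻¹ * v' (y + offZ L r) : 𝔸ˣ)) : 𝔸) + asum (Ab v') y (seg μ (L : ℤ))) := by
      funext r
      rw [asum_loop, disp_treeWord, disp_seg, ← hy']
      abel
    rw [hpt, bmean_lin hL, ← SexpZ_eq_bmean, ← SexpZ_eq_bmean, hMd]
    abel
  -- sizes of the pieces
  have hmain : ∀ r : Fin d → Fin L, ‖asum (Ab v') (y + offZ L r) (seg μ (L : ℤ))‖ ≤ L * a := by
    intro r
    have h := norm_asum_le (Ab v') (y + offZ L r) (l1 (y + offZ L r - (y + offZ L r)) + (seg μ (L : ℤ)).length)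
      ha0 (fun x κ _ => (hVA x κ).2) (seg μ (L : ℤ)) (y + offZ L r) le_rfl
    rwa [length_seg_nat] at h
  have hloop : ∀ r : Fin d → Fin L, ‖asum (Ab v') y (treeWord (offZ L r) ++ seg μ (L : ℤ) ++
      revWord (treeWord (offZ L r)) ++ revWord (seg μ (L : ℤ)))‖ ≤ 4 * θ ^ 2 :=
    fun r => loop_walkZ ha0 hVA hθ0 (hθ1.trans (by norm_num)) hLa y r μ
  have hG : ‖bmean L (fun r => asum (Ab v') (y + offZ L r) (seg μ (L : ℤ)) -
        asum (Ab v') y (treeWord (offZ L r) ++ seg μ (L : ℤ) ++ revWord (treeWord (offZ L r)) ++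
          revWord (seg μ (L : ℤ))) +
        ((mlog ((((v' y')⁻¹ * v' (y' + offZ L r) : 𝔸ˣ)) : 𝔸) - asum (Ab v') y' (treeWord (offZ L r))) -
         (mlog ((((v' y)⁻¹ * v' (y + offZ L r) : 𝔸ˣ)) : 𝔸) - asum (Ab v') y (treeWord (offZ L r)))))‖ ≤
      L * a + 4 * θ ^ 2 + (17 * θ ^ 2 + 17 * θ ^ 2) := by
    refine norm_bmean_le hL fun r => ?_
    refine (norm_add_le _ _).trans (add_le_add ((norm_sub_le _ _).trans (add_le_add (hmain r) (hloop r))) ?_)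
    exact (norm_sub_le _ _).trans (add_le_add (hb y' r).2.2.1 (hb y r).2.2.1)
  have hΦΦ : ‖Φ' - Φ‖ ≤ 2 * φ := (norm_sub_le _ _).trans (by linarith)
  have hM1 : ‖M‖ ≤ L * a + 2055 * θ ^ 2 + 2 * φ := by
    rw [hMid]
    refine (norm_add_le _ _).trans ?_
    refine (add_le_add ((norm_add₃_le).trans (add_le_add (add_le_add hG hc3) hΦΦ)) hρ').trans ?_
    linarith
  have hM2 : ‖M‖ ≤ 14 * θ := by nlinarith
  have hM3 : |‖M‖| ≤ 1 := by rw [abs_of_nonneg (norm_nonneg _)]; linarith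
  have hexp : ‖exp M - 1‖ ≤ ‖M‖ + ‖M‖ ^ 2 := by
    have h1 := B7Transfer.norm_exp_sub_one_le_of_le M le_rfl
    have h2 := Real.abs_exp_sub_one_sub_id_le hM3
    have h3 := le_abs_self (Real.exp ‖M‖ - 1 - ‖M‖)
    linarith
  have hMsq : ‖M‖ ^ 2 ≤ (14 * θ) ^ 2 := pow_le_pow_left₀ (norm_nonneg _) hM2 2
  have hφq : 2 * φ = 368 * θ * q := by rw [hφd]; ring
  nlinarith


/-! ## §5 Proposition 9 (flat background), assembled in print's parameters -/

/-- **Proposition 9 at the flat background `V₀ = 1`** (p. 49): "There exist positive constants `C′₄, C′₅, c′₆` such that for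
arbitrary functions `V₀, v′, v₁` satisfying (180) with `α₀, α₃, α′₃, α₄, α′₄ ≦ c′₆`, the following bounds hold:
`|ṽ′⁻¹(c₋)R̄_{0,c}ṽ′(c₊) − 1| < Lα′₄ + C′₄L²(α₀α₄ + α′₃α′₄ + α′₄²)`, (199)  `|ṽ′(y) − 1| < α₄ + C′₅Lα′₄`. (200)"
Kernel form, `V₀ = 1` (so `α₀ = 0`, `R₀ = R̄₀ = id`), all of `ℤ^d` for `Ω`, `≤` for `<`, `ṽ′` in coarse coordinates (`vtil`):
under (180a) `‖v′ − 1‖ ≤ α₄ ≤ 1`, (180b) `‖v′(x)⁻¹v′(x+e_κ) − 1‖ ≤ α′₄`, (180c) `‖v₁ − 1‖ ≤ α₃ ≤ 1/5`, (180d)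
`‖v₁(y)⁻¹v₁(x) − 1‖ ≤ Lα′₃` on blocks, and the smallness `50Lα′₃ ≤ 1`, `10³(d+1)Lα′₄ ≤ 1` (print's `c′₆`, here depending on
`d` and `L`): (199) `‖ṽ′(z)⁻¹ṽ′(z + e_μ) − 1‖ ≤ Lα′₄ + C′₄L²(α′₃α′₄ + α′₄²)` for every coarse bond and (200)
`‖ṽ′(z) − 1‖ ≤ α₄ + C′₅Lα′₄` for every coarse site, with `C′₄ = 10⁴(d+1)²`, `C′₅ = 64(d+1)`.  The conclusions have exactly
the shape of the hypotheses (180a)/(180b) one scale up — the input of the induction of Proposition 10.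
[cite: Balaban1985Averaging, Proposition 9 p.49, (176)–(200) pp.45–49] -/
theorem prop9_flatZ {L : ℕ} (hL : 1 ≤ L) {v' v₁ : SiteZ d → 𝔸ˣ} {α₃ α₃' α₄ α₄' : ℝ}
    (h4a : SiteBd v' α₄) (h4b : BondBd v' α₄') (h3c : SiteBd v₁ α₃)
    (h3d : ∀ (z : SiteZ d) (r : Fin d → Fin L), ‖((((v₁ ((L : ℤ) • z))⁻¹ * v₁ ((L : ℤ) • z + offZ L r) : 𝔸ˣ)) : 𝔸) - 1‖ ≤ L * α₃')
    (hα₄ : α₄ ≤ 1) (hα₄' : 0 ≤ α₄') (hα₃ : α₃ ≤ 1 / 5) (hα₃' : 50 * (L * α₃') ≤ 1)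
    (hs : 1000 * ((d : ℝ) + 1) * L * α₄' ≤ 1) :
    BondBd (fun z => savgZ L (v' * v₁) ((L : ℤ) • z) * (savgZ L v₁ ((L : ℤ) • z))⁻¹) (L * α₄' + C4' d * L ^ 2 * (α₃' * α₄' + α₄' ^ 2)) ∧
      SiteBd (fun z => savgZ L (v' * v₁) ((L : ℤ) • z) * (savgZ L v₁ ((L : ℤ) • z))⁻¹) (α₄ + C5' d * L * α₄') := by
  obtain ⟨hVA, h4, ha0, ha2, hθ0, hθ1, hθ2⟩ := setup hL h4b hα₄' hs
  have hL' : (1 : ℝ) ≤ L := by exact_mod_cast hL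
  have hK : (1 : ℝ) ≤ (d : ℝ) + 1 := by have := Nat.cast_nonneg (α := ℝ) d; linarith
  have hw' : ∀ x, ‖((v₁ x : 𝔸ˣ) : 𝔸) - 1‖ ≤ 2 / 5 := fun x => (h3c x).trans (by linarith)
  have hw : ∀ x, ‖((((v₁ x)⁻¹ : 𝔸ˣ)) : 𝔸) - 1‖ ≤ 2 / 5 := fun x =>
    (norm_units_inv_sub_one_le (v₁ x) ((h3c x).trans (by linarith))).trans (by linarith [h3c x])
  have hq1 : (L : ℝ) * α₃' ≤ 1 / 50 := by linarith
  have hq0 : 0 ≤ (L : ℝ) * α₃' := (norm_nonneg _).trans (h3d 0 fun _ => ⟨0, hL⟩)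
  constructor
  · intro z μ
    have key := core199Z hL ha0 hVA hθ0 hθ1 le_rfl hw hw' hq1 ((L : ℤ) • z) μ (fun r => h3d z r)
      (fun r => by have h := h3d (z + e μ) r; rwa [smul_add] at h)
    show ‖((((savgZ L (v' * v₁) ((L : ℤ) • z) * (savgZ L v₁ ((L : ℤ) • z))⁻¹)⁻¹ *
        (savgZ L (v' * v₁) ((L : ℤ) • (z + e μ)) * (savgZ L v₁ ((L : ℤ) • (z + e μ)))⁻¹) : 𝔸ˣ)) : 𝔸) - 1‖ ≤ _
    rw [smul_add]
    calc _ ≤ _ := key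
      _ ≤ _ := arith199 hK hL' hα₄' h4 hq0
      _ = _ := by rw [C4']; ring
  · intro z
    have key := core200Z hL ha0 hVA hθ0 hθ1 le_rfl hw hw' hq1 hα₄ ((L : ℤ) • z) (fun r => h3d z r) (h4a _)
    have h2 := arith200 hK hL' hα₄' h4 hq1
    calc _ ≤ _ := key
      _ ≤ α₄ + 64 * ((d : ℝ) + 1) * L * α₄' := by linarith
      _ = _ := by rw [C5']

end Prop9

end Literature.MathematicalPhysics.QuantumFieldTheory.Balaban1983to89.B7Prop9FlatRec
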